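import Literature.AlgebraicGeometry.Resolution.VertexBlowupProjectionMorphism
import Summits.ResolutionOfSingularities.ResolutionOfSingularities.Theorems.EquisingularLiftEquisingularLiftNatVanishingIdealOfChart
import HarnessLib

/-!
# [OURS · L1 W4.5(b) · EL♮(3) · nose residue, (c) file 1] HOW THE VERTEX CHARTS OVERLAP: a point of the `i`-th chart at which
# `X_j/X_i` does not vanish lies in the `j`-th chart

Crux chain w45b, child EL♮(3) = stmt-ResolutionOfSingularities-20148; WIDTH seat res-L1-w45b-nose-w3 g3 (D-0157 DOOR 1), brick (c) = the
×3 UNION certificate `DirStepUnobs F₂ univ (⋃ i, vertexLineStrict υ i)` of res-L1-w45b-nose-w2's «Steiner ∈ ν2» assembly (027's (U1)); this file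
is its first, generic piece (needed for the COVER clause: the points of the three strict-transform lines on the exceptional divisor all lie in ONE
vertex chart). `--supports stmt-ResolutionOfSingularities-20148 --as helper`. OURS; NOT a statement of any manuscript (nothing of [Hironaka2017]);
AI-written, weaker than expert review. No `sorry`; standard axioms; DEF-FREE (the de Jong kit's `attribute [local instance] MvPolynomial.gradedAlgebra`
is needed to write `Proj k[x]`). Resolution in positive characteristic is NOT proved here (dim 3: Cossart–Piltant 2008/2009 in print).

SETTING (tree's de Jong Lemma 4.11 vertex kit, `Literature/…/VertexBlowupCharts`, `…/VertexBlowupProjectionMorphism`, `…/BlowupPrincipalCharts`):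
ANY blowing up `b : P̃ ⟶ ℙ^{d+1}_k` of the vertex; the charts `cᵢ = vertexChart hb i : Spec Cᵢ ⟶ P̃`, `Cᵢ = k[X][I/Xᵢ]`, whose images are the
PRINCIPAL CHARTS `P̃[D₊(x_{d+1}), xᵢ/x_{d+1}]` (`opensRange_vertexChart`, `IsBlowup.isPrincipalChart_blowupChart`).

WHAT.
* `res_blowupSection_eq_mul` — on `cᵢ(Spec Cᵢ)`: `b^*(x_j/x_{d+1}) = b^*(x_i/x_{d+1}) · rᵢⱼ` with `θᵢ(rᵢⱼ) = X_j/X_i` (`appIso_hom_blowupSection`).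
* `vertexChart_apply_mem_basicOpen_iff` — `cᵢ 𝔭 ∈ D(rᵢⱼ) ↔ X_j/X_i ∉ 𝔭`.
* ★ `isPrincipalChart_basicOpen_ratio` — `D(rᵢⱼ) ⊆ cᵢ(Spec Cᵢ)` is a principal chart FOR THE GENERATOR `x_j/x_{d+1}` (there `rᵢⱼ` is a unit, so
  `b^*(x_j/x_{d+1})` is again a regular generator of `𝓘{p}·𝒪`; `IsPrincipalChart.of_le`, `RingedSpace.isUnit_res_basicOpen`).
* ★★ `vertexChart_mem_opensRange_of_frac_notMem` — **if `X_j/X_i ∉ 𝔭` then `cᵢ 𝔭 ∈ cⱼ(Spec Cⱼ)`** (`mem_blowupChart_iff`). [Stacks 0804: the charts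
  `Spec A[I/a]`, `Spec A[I/a']` overlap where `a'/a` is invertible.]

References (index only): The Stacks Project, Tag 0804 [cite: StacksProject]; A. J. de Jong (1996), proof of Lemma 4.11 [cite: DeJong1996];
U. Görtz, T. Wedhorn, *Algebraic Geometry I* (2020), Prop. 13.91/13.92 [cite: GortzWedhorn2020].
-/

set_option linter.dupNamespace false -- mandated namespace `Summit.<Summit>.<Problem>` of this single-conjunct summit

noncomputable section

open CategoryTheory AlgebraicGeometry TopologicalSpace HomogeneousLocalization Topology Opposite
open Literature.AlgebraicGeometry.Resolution Literature.AlgebraicGeometry.Resolution.DeJong1996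
open Literature.AlgebraicGeometry.Resolution.PointBlowup (Chart frac exc)
open Literature.AlgebraicGeometry.Motives.Segre (grading X_mem)

attribute [local instance] MvPolynomial.gradedAlgebra

namespace Summit.ResolutionOfSingularities.ResolutionOfSingularities.Cruxes.EquisingularLiftNat.Sections

section Overlap

variable {d : ℕ} {k : Type} [Field k] {P : Scheme.{0}} {b : P ⟶ Proj (grading (Fin (d + 1 + 1)) k)}
  (hb : IsBlowup b (vertexIdealSheaf d k)) (i j : Fin (d + 1))

/-- **On the `i`-th vertex chart, `b^*(x_j/x_{d+1}) = b^*(x_i/x_{d+1}) · rᵢⱼ`** where `rᵢⱼ` is the section with `θᵢ(rᵢⱼ) = X_j/X_i`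
(both sides read `X_i · X_j/X_i` in `Cᵢ`, `appIso_hom_blowupSection`). [cite: StacksProject, Tag 0804] (folklore) -/
theorem res_blowupSection_eq_mul :
    P.presheaf.map (homOfLE (image_top_le_preimage_lastChart b hb i)).op (blowupSection b j) =
      P.presheaf.map (homOfLE (image_top_le_preimage_lastChart b hb i)).op (blowupSection b i) *
        ((vertexChart hb i).appIso ⊤).inv ((Scheme.ΓSpecIso (.of (Chart d k i))).inv (frac d k i j)) := by
  apply ((vertexChart hb i).appIso ⊤).commRingCatIsoToRingEquiv.injective
  change ((vertexChart hb i).appIso ⊤).hom _ = ((vertexChart hb i).appIso ⊤).hom (_ * _)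
  rw [map_mul, appIso_hom_blowupSection b hb i j, appIso_hom_blowupSection b hb i i, PointBlowup.frac_self, mul_one,
    Iso.inv_hom_id_apply, ← map_mul]

/-- **`cᵢ 𝔭 ∈ D(rᵢⱼ) ↔ X_j/X_i ∉ 𝔭`** (the basic open of `rᵢⱼ` is the image of `D(X_j/X_i) ⊆ Spec Cᵢ`). [folklore] -/
theorem vertexChart_apply_mem_basicOpen_iff (𝔭 : Spec (.of (Chart d k i))) :
    vertexChart hb i 𝔭 ∈ P.basicOpen (((vertexChart hb i).appIso ⊤).inv ((Scheme.ΓSpecIso (.of (Chart d k i))).inv (frac d k i j))) ↔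
      frac d k i j ∉ 𝔭.asIdeal := by
  rw [← Scheme.image_basicOpen (vertexChart hb i), basicOpen_eq_of_affine', Iso.inv_hom_id_apply]
  change vertexChart hb i 𝔭 ∈ (vertexChart hb i) '' _ ↔ _
  rw [(vertexChart hb i).isOpenEmbedding.injective.mem_set_image]
  exact PrimeSpectrum.mem_basicOpen (frac d k i j) 𝔭

/-- ★ **`D(rᵢⱼ) ⊆ cᵢ(Spec Cᵢ)` is a principal chart for the generator `x_j/x_{d+1}`**: on it `b^*(x_j/x_{d+1}) = b^*(x_i/x_{d+1}) · (unit)` is a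
regular generator of `𝓘{p}·𝒪_{P̃}` (the image `cᵢ(Spec Cᵢ)` is the principal chart for `x_i/x_{d+1}`, `IsBlowup.isPrincipalChart_blowupChart`,
and principal charts shrink, `IsPrincipalChart.of_le`). [cite: GortzWedhorn2020, Prop. 13.92] (OURS instance; folklore) -/
theorem isPrincipalChart_basicOpen_ratio :
    IsPrincipalChart b (vertexIdealSheaf d k) (lastChart d k) (vertexSection d k j)
      ⟨P.basicOpen (((vertexChart hb i).appIso ⊤).inv ((Scheme.ΓSpecIso (.of (Chart d k i))).inv (frac d k i j))),
        (isAffineOpen_image_top (vertexChart hb i)).basicOpen _⟩ := by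
  set r := ((vertexChart hb i).appIso ⊤).inv ((Scheme.ΓSpecIso (.of (Chart d k i))).inv (frac d k i j)) with hr
  -- the image of the `i`-th chart is the principal chart for `x_i/x_{d+1}`
  have hA : IsPrincipalChart b (vertexIdealSheaf d k) (lastChart d k) (vertexSection d k i)
      ⟨vertexChart hb i ''ᵁ ⊤, isAffineOpen_image_top (vertexChart hb i)⟩ := by
    have e : (⟨vertexChart hb i ''ᵁ ⊤, isAffineOpen_image_top (vertexChart hb i)⟩ : P.affineOpens) =
        ⟨blowupChart b (vertexIdealSheaf d k) (lastChart d k) (vertexSection d k i),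
          hb.isAffineOpen_blowupChart (vertexSection_mem d k i)⟩ :=
      Subtype.ext ((Scheme.Hom.image_top_eq_opensRange _).trans (opensRange_vertexChart hb i))
    rw [e]
    exact hb.isPrincipalChart_blowupChart (vertexSection_mem d k i)
  -- shrink to `D(r)`
  have hW : (P.basicOpen r : P.Opens) ≤ vertexChart hb i ''ᵁ ⊤ := P.basicOpen_le r
  obtain ⟨h, hnzd, hideal⟩ := hA.of_le (W' := ⟨P.basicOpen r, (isAffineOpen_image_top (vertexChart hb i)).basicOpen r⟩) hW
  -- the two generators differ by the unit `r|_{D(r)}`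
  have hu : IsUnit (P.presheaf.map (homOfLE hW).op r) := P.toRingedSpace.isUnit_res_basicOpen r
  have hgen : b.appLE (lastChart d k) (P.basicOpen r) h (vertexSection d k j) =
      b.appLE (lastChart d k) (P.basicOpen r) h (vertexSection d k i) * P.presheaf.map (homOfLE hW).op r := by
    have hAi : b.appLE (lastChart d k) (vertexChart hb i ''ᵁ ⊤) (image_top_le_preimage_lastChart b hb i) (vertexSection d k i) =
        P.presheaf.map (homOfLE (image_top_le_preimage_lastChart b hb i)).op (blowupSection b i) := rfl
    have hAj : b.appLE (lastChart d k) (vertexChart hb i ''ᵁ ⊤) (image_top_le_preimage_lastChart b hb i) (vertexSection d k j) =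
        P.presheaf.map (homOfLE (image_top_le_preimage_lastChart b hb i)).op (blowupSection b j) := rfl
    rw [← map_appLE_eq (image_top_le_preimage_lastChart b hb i) hW (vertexSection d k j),
      ← map_appLE_eq (image_top_le_preimage_lastChart b hb i) hW (vertexSection d k i), hAi, hAj,
      res_blowupSection_eq_mul hb i j, map_mul]
  refine ⟨h, ?_, ?_⟩
  · rw [hgen]
    exact Submonoid.mul_mem _ hnzd hu.mem_nonZeroDivisors
  · rw [hideal, hgen, Ideal.span_singleton_mul_right_unit hu]

/-- ★★ **How the vertex charts overlap**: a point `𝔭` of the `i`-th chart `Spec Cᵢ` with `X_j/X_i ∉ 𝔭` is (mapped to) a point of the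
`j`-th chart `cⱼ(Spec Cⱼ)` — the latter is the principal chart for `x_j/x_{d+1}` and `D(rᵢⱼ) ∋ cᵢ 𝔭` is one (`mem_blowupChart_iff`).
[cite: StacksProject, Tag 0804] (OURS instance; folklore) -/
theorem vertexChart_mem_opensRange_of_frac_notMem (𝔭 : Spec (.of (Chart d k i))) (h𝔭 : frac d k i j ∉ 𝔭.asIdeal) :
    vertexChart hb i 𝔭 ∈ (vertexChart hb j).opensRange := by
  rw [opensRange_vertexChart hb j, mem_blowupChart_iff]
  exact ⟨_, isPrincipalChart_basicOpen_ratio hb i j, (vertexChart_apply_mem_basicOpen_iff hb i j 𝔭).mpr h𝔭⟩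

end Overlap

end Summit.ResolutionOfSingularities.ResolutionOfSingularities.Cruxes.EquisingularLiftNat.Sections

end
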